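import Summits.BirchSwinnertonDyer.BirchSwinnertonDyer.Theorems.AlignedTransportAtTwoMainConjectureOfRankZeroBSDAtTwoHalfDescentDivisibility
import Summits.BirchSwinnertonDyer.BirchSwinnertonDyer.Theorems.AlignedTransportAtTwoMainConjectureOfRankZeroBSDAtTwoHalfDescentTwistZero
import HarnessLib

/-!
# Route `AlignedTransportAtTwo`, crux C2 `MainConjectureOfRankZeroBSDAtTwo` (stmt-BirchSwinnertonDyer-22298):
# KATO IN HALF-DEGREE COORDINATES, II — `F ∣ p^a·G` in `Λ = ℤ_p⟦T⟧` IS `P_F ∣ P_G`; for `ι`-stable `F, G` it reads **`k_F ≤ k_G` and `h_F ∣ h_G`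
# in `ℤ_p[Y]`**; with `λ(F) = λ(G)` it pins `(k, h)` (any `p`)

HONEST FRAMING (cell `bsd-f1-sign2`, WIDTH-5 attached prover seat `bsd-line-att-p5` gen 52 on line `birth` of the lead `bsd-line-att-p2`;
`--supports` stmt-BirchSwinnertonDyer-22298, closes nothing; BSD is NOT proved by any of this; the crux C2, its verdict «blocked-on
`Rank1Residual.GreenbergMuConjectureIrreducible`» and every registered stub (P / T / Kμ / LimDoor / MuIneqʳ / PFμ⁺) are untouched). THEOREMS ONLY —
pure algebra of `Λ`, any prime `p`; no `def`, no instance, no named fact, no `sorry`. Lineage glue on g51's successor (ii′) «Kato in coordinates».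
Kato's theorem at `2` has the shape `char_Λ X ∋ g`, `ι g = 2^n · L₂(f, α)` (tree fact `kato_divisibility_allPrimes`), i.e. `f_X ∣ 2^n·G` for an
integral lift `G`; the `μ`-invariants are invisible to such a divisibility, everything else is carried by the distinguished polynomials.
* §3 (`Λ`, any `F, G ≠ 0`; `P_F` = distinguished polynomial of the `p`-free part, `F = p^{μ(F)}·P_F·U_F`):
  ★★ **`weierstrassDistinguished_pfree_dvd_of_dvd_C_pow_mul`** (`F ∣ p^a G ⟹ P_F ∣ P_G`: the `p`-free parts multiply and Weierstrass preparation is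
  multiplicative); converse ★ `dvd_C_pow_mul_of_weierstrassDistinguished_dvd`
  (`P_F ∣ P_G ⟹ F ∣ p^{μ(F)} G`) — so «`F ∣ p^a G` for SOME `a`» is EXACTLY «`P_F ∣ P_G`» —, `dvd_of_weierstrassDistinguished_dvd_of_mu_le`
  (`+ μ(F) ≤ μ(G) ⟹ F ∣ G`); RIGIDITY ★★ `weierstrassDistinguished_eq_of_dvd_of_lam_eq` (`F ∣ p^a G`, `λ(F) = λ(G)` ⟹ `P_F = P_G` and
  `pfree G = pfree F · unit` — Greenberg–Vatsal p. 4 «the equality `λ_alg = λ_an` implies that `f_alg` and `f_an` differ by a power of `p`»).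
* §4 (`ι`-stable elements in g51's normal form `P = (T+2)^k·𝒯'_m(h)`, `k = ord_{−2}P`, `h` monic of degree `m`): `eval_neg_two_ne_zero_of_twistZero`
  (normalised ⟹ `h(−2) ≠ 0`); ★★★ **`realCounterpart_dvd_of_dvd_C_pow_mul`** — KATO IN COORDINATES: **`F ∣ p^a·G ⟹ h_F ∣ h_G` in `ℤ_p[Y]`** and
  `k_F ≤ k_G + ord_{−2}𝒯'(h_G)`, `k_F ≤ k_G` when `k_G = ord_{−2}P_G`; ★★ `realCounterpart_eq_of_dvd_C_pow_mul_of_lam_eq` (`+ λ(F) = λ(G)` ⟹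
  `k_F = k_G`, `m_F = m_G`, `h_F = h_G`: what is left of the main conjecture is `μ_F = μ_G`).
Sequel `…HalfDescentDefect`: the defect polynomial `r = h_G / h_F ≡ (Y − 2)^d (mod p)`, the value laws, the conservation law on weight-certified pairs.
Memo `Cruxes/MainConjectureOfRankZeroBSDAtTwo/KATO-COORDINATES-att-p5-g52.md`. BSD is not proved by any of this; nothing about any curve is asserted here.

References: L. Washington, GTM 83, §7.1 (Weierstrass preparation) [Washington1997]; R. Greenberg, V. Vatsal, Invent. Math. 142 (2000) pp. 2–4
[GreenbergVatsal2000]; R. Greenberg, LNM 1716 (1999) p. 180 [GreenbergLNM1716]; K. Kato, Astérisque 295 (2004) Thm. 17.4 [Kato2004Asterisque];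
M. Goresky, Y.-S. Tai, arXiv:1701.07742, App. §16.2 Prop. 36 [GoreskyTai2017RealStructuresOrdinary]; B. Mazur, J. Tate, J. Teitelbaum, Invent. Math. 84
(1986) Ch. I §17 [MazurTateTeitelbaum1986Invent].
-/

set_option linter.dupNamespace false
set_option autoImplicit false

noncomputable section

open scoped Classical

namespace Summit.BirchSwinnertonDyer.BirchSwinnertonDyer.Theorems.AlignedTransportAtTwoHalfDescentKato

open Literature.Algebra.Polynomial.QPalindromicRealCounterpart
  Summit.BirchSwinnertonDyer.BirchSwinnertonDyer.Theorems.AlignedTransportAtTwoHalfDescentDivisibility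

/-! ## §3 In `Λ = ℤ_p⟦T⟧`: `F ∣ p^a·G` is `P_F ∣ P_G` -/

section Lambda

open PowerSeries Literature.NumberTheory.EllipticCurves
  Literature.NumberTheory.EllipticCurves.IwasawaAlgebra
  Summit.BirchSwinnertonDyer.Rank1Residual.X1.MuLambda
  Summit.BirchSwinnertonDyer.Rank1Residual.Iwasawa

variable {p : ℕ} [hp : Fact p.Prime]

/-- The Weierstrass polynomial depends only on the power series (transport along an equality). [folklore] -/
private theorem weierstrassDistinguished_congr {g g' : IwasawaAlgebra p} (e : g = g') (hg : g.map (IsLocalRing.residue ℤ_[p]) ≠ 0)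
    (hg' : g'.map (IsLocalRing.residue ℤ_[p]) ≠ 0) : g.weierstrassDistinguished hg = g'.weierstrassDistinguished hg' := by
  subst e; rfl

/-- `p`-power scaling does not change the `p`-free part: `pfree (p^a·G) = pfree G`. [folklore] -/
private theorem pfree_C_pow_mul_eq (a : ℕ) {G : IwasawaAlgebra p} (hG : G ≠ 0) : pfree (PowerSeries.C ((p : ℤ_[p]) ^ a) * G) = pfree G := by
  have h : PowerSeries.C ((p : ℤ_[p]) ^ a) * G = PowerSeries.C ((p : ℤ_[p]) ^ (a + mu G)) * pfree G := by
    conv_lhs => rw [eq_C_pow_mu_mul_pfree G]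
    rw [pow_add, map_mul, mul_assoc]
  exact (mu_eq_and_pfree_eq (red_pfree_ne_zero hG) h).2

/-- ★★ **`F ∣ p^a·G ⟹ P_F ∣ P_G`** in `ℤ_p[T]`, where `P_F` is the distinguished polynomial of the `p`-free part of `F` (`F = p^{μ(F)}·P_F·U_F`):
from `p^a G = F·q` the `p`-free parts multiply, `pfree G = pfree F · pfree q`, and Weierstrass preparation is multiplicative. This is the
shape of Kato's theorem at `2` (`char X ∋ g`, `ι g = 2^n·L`). [cite: Washington1997, §7.1 (Weierstrass preparation, uniqueness)]
[cite: Kato2004Asterisque, Thm. 17.4 (1)(2) (p. 273)] -/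
theorem weierstrassDistinguished_pfree_dvd_of_dvd_C_pow_mul {F G : IwasawaAlgebra p} (hF : F ≠ 0) (hG : G ≠ 0) {a : ℕ}
    (hdvd : F ∣ PowerSeries.C ((p : ℤ_[p]) ^ a) * G) :
    (pfree F).weierstrassDistinguished (red_pfree_ne_zero hF) ∣ (pfree G).weierstrassDistinguished (red_pfree_ne_zero hG) := by
  obtain ⟨q, hq⟩ := hdvd
  have hne : PowerSeries.C ((p : ℤ_[p]) ^ a) * G ≠ 0 := mul_ne_zero (C_pow_ne_zero a) hG
  have hq0 : q ≠ 0 := fun h0 ↦ hne (by rw [hq, h0, mul_zero])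
  have hpf : pfree G = pfree F * pfree q := by rw [← pfree_C_pow_mul_eq a hG, hq, pfree_mul hF hq0]
  have hred : (pfree F * pfree q).map (IsLocalRing.residue ℤ_[p]) ≠ 0 := by
    rw [map_mul]; exact mul_ne_zero (red_pfree_ne_zero hF) (red_pfree_ne_zero hq0)
  rw [weierstrassDistinguished_congr hpf (red_pfree_ne_zero hG) hred, PowerSeries.weierstrassDistinguished_mul]
  exact dvd_mul_right _ _

/-- ★ **Converse: `P_F ∣ P_G ⟹ F ∣ p^{μ(F)}·G`** (`F = p^{μ_F} P_F U_F`, `G = p^{μ_G} P_G U_G`, `P_G = P_F Q`). So «`F ∣ p^a G` for SOME `a`» is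
EXACTLY «`P_F ∣ P_G`»: the `μ`-invariants are invisible to a divisibility up to `p`-powers (Kato at `2`).
[cite: Washington1997, §7.1 (Weierstrass preparation, uniqueness)] -/
theorem dvd_C_pow_mul_of_weierstrassDistinguished_dvd {F G : IwasawaAlgebra p} (hF : F ≠ 0) (hG : G ≠ 0)
    (hdvd : (pfree F).weierstrassDistinguished (red_pfree_ne_zero hF) ∣ (pfree G).weierstrassDistinguished (red_pfree_ne_zero hG)) :
    F ∣ PowerSeries.C ((p : ℤ_[p]) ^ mu F) * G := by
  obtain ⟨Q, hQ⟩ := hdvd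
  have hfF := (pfree F).eq_weierstrassDistinguished_mul_weierstrassUnit (red_pfree_ne_zero hF)
  have hfG := (pfree G).eq_weierstrassDistinguished_mul_weierstrassUnit (red_pfree_ne_zero hG)
  obtain ⟨u, hu⟩ := (pfree F).isUnit_weierstrassUnit (red_pfree_ne_zero hF)
  refine ⟨PowerSeries.C ((p : ℤ_[p]) ^ mu G) * (Q : IwasawaAlgebra p) * (↑u⁻¹ * (pfree G).weierstrassUnit (red_pfree_ne_zero hG)), ?_⟩
  conv_lhs => rw [eq_C_pow_mu_mul_pfree G, hfG, hQ, Polynomial.coe_mul]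
  conv_rhs => rw [eq_C_pow_mu_mul_pfree F, hfF, ← hu]
  calc PowerSeries.C ((p : ℤ_[p]) ^ mu F) * (PowerSeries.C ((p : ℤ_[p]) ^ mu G) *
        (((pfree F).weierstrassDistinguished (red_pfree_ne_zero hF) : IwasawaAlgebra p) * (Q : IwasawaAlgebra p) *
          (pfree G).weierstrassUnit (red_pfree_ne_zero hG)))
      = PowerSeries.C ((p : ℤ_[p]) ^ mu F) * ((pfree F).weierstrassDistinguished (red_pfree_ne_zero hF) : IwasawaAlgebra p) * ((u : IwasawaAlgebra p) * ↑u⁻¹) *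
          (PowerSeries.C ((p : ℤ_[p]) ^ mu G) * (Q : IwasawaAlgebra p) * (pfree G).weierstrassUnit (red_pfree_ne_zero hG)) := by
        rw [Units.mul_inv, mul_one]; ring
    _ = PowerSeries.C ((p : ℤ_[p]) ^ mu F) * (((pfree F).weierstrassDistinguished (red_pfree_ne_zero hF) : IwasawaAlgebra p) * ↑u) *
          (PowerSeries.C ((p : ℤ_[p]) ^ mu G) * (Q : IwasawaAlgebra p) * (↑u⁻¹ * (pfree G).weierstrassUnit (red_pfree_ne_zero hG))) := by ring

/-- **With the `μ`-inequality the divisibility is genuine**: `P_F ∣ P_G` and `μ(F) ≤ μ(G)` ⟹ `F ∣ G`. [cite: Washington1997, §7.1] [cite: GreenbergVatsal2000, p. 4] -/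
theorem dvd_of_weierstrassDistinguished_dvd_of_mu_le {F G : IwasawaAlgebra p} (hF : F ≠ 0) (hG : G ≠ 0)
    (hdvd : (pfree F).weierstrassDistinguished (red_pfree_ne_zero hF) ∣ (pfree G).weierstrassDistinguished (red_pfree_ne_zero hG))
    (hμ : mu F ≤ mu G) : F ∣ G := by
  obtain ⟨d, hd⟩ := Nat.exists_eq_add_of_le hμ
  -- `F = p^{μ_F} P_F U_F`, `G = p^{μ_F} p^d P_F Q U_G = F · (p^d Q U_F⁻¹ U_G)`
  have hG' : G = PowerSeries.C ((p : ℤ_[p]) ^ mu F) * (PowerSeries.C ((p : ℤ_[p]) ^ d) * pfree G) := by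
    conv_lhs => rw [eq_C_pow_mu_mul_pfree G, hd]
    rw [pow_add, map_mul, mul_assoc]
  obtain ⟨Q, hQ⟩ := hdvd
  have hfF := (pfree F).eq_weierstrassDistinguished_mul_weierstrassUnit (red_pfree_ne_zero hF)
  have hfG := (pfree G).eq_weierstrassDistinguished_mul_weierstrassUnit (red_pfree_ne_zero hG)
  obtain ⟨u, hu⟩ := (pfree F).isUnit_weierstrassUnit (red_pfree_ne_zero hF)
  refine ⟨PowerSeries.C ((p : ℤ_[p]) ^ d) * (Q : IwasawaAlgebra p) * (↑u⁻¹ * (pfree G).weierstrassUnit (red_pfree_ne_zero hG)), ?_⟩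
  conv_lhs => rw [hG', hfG, hQ, Polynomial.coe_mul]
  conv_rhs => rw [eq_C_pow_mu_mul_pfree F, hfF, ← hu]
  calc PowerSeries.C ((p : ℤ_[p]) ^ mu F) * (PowerSeries.C ((p : ℤ_[p]) ^ d) *
        (((pfree F).weierstrassDistinguished (red_pfree_ne_zero hF) : IwasawaAlgebra p) * (Q : IwasawaAlgebra p) *
          (pfree G).weierstrassUnit (red_pfree_ne_zero hG)))
      = PowerSeries.C ((p : ℤ_[p]) ^ mu F) * ((pfree F).weierstrassDistinguished (red_pfree_ne_zero hF) : IwasawaAlgebra p) * ((u : IwasawaAlgebra p) * ↑u⁻¹) *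
          (PowerSeries.C ((p : ℤ_[p]) ^ d) * (Q : IwasawaAlgebra p) * (pfree G).weierstrassUnit (red_pfree_ne_zero hG)) := by
        rw [Units.mul_inv, mul_one]; ring
    _ = PowerSeries.C ((p : ℤ_[p]) ^ mu F) * (((pfree F).weierstrassDistinguished (red_pfree_ne_zero hF) : IwasawaAlgebra p) * ↑u) *
          (PowerSeries.C ((p : ℤ_[p]) ^ d) * (Q : IwasawaAlgebra p) * (↑u⁻¹ * (pfree G).weierstrassUnit (red_pfree_ne_zero hG))) := by ring

/-- ★★ **RIGIDITY: `F ∣ p^a·G` and `λ(F) = λ(G)` ⟹ `P_F = P_G`** (a monic divisor of a monic polynomial of the same degree is the polynomial);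
hence `pfree G = pfree F · unit` — Greenberg–Vatsal: «the equality `λ_alg = λ_an` implies that `f_alg` and `f_an` differ by multiplication by a
power of `p`». [cite: GreenbergVatsal2000, p. 4 (after Thm. (1.2))] [cite: GreenbergLNM1716, p. 180] -/
theorem weierstrassDistinguished_eq_of_dvd_of_lam_eq {F G : IwasawaAlgebra p} (hF : F ≠ 0) (hG : G ≠ 0) {a : ℕ}
    (hdvd : F ∣ PowerSeries.C ((p : ℤ_[p]) ^ a) * G) (hlam : lam F = lam G) :
    (pfree F).weierstrassDistinguished (red_pfree_ne_zero hF) = (pfree G).weierstrassDistinguished (red_pfree_ne_zero hG) ∧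
      ∃ u : (IwasawaAlgebra p)ˣ, pfree G = pfree F * u := by
  have hP := weierstrassDistinguished_pfree_dvd_of_dvd_C_pow_mul hF hG hdvd
  have hdF := lam_eq_natDegree_weierstrassDistinguished (eq_C_pow_mu_mul_pfree F) (red_pfree_ne_zero hF)
  have hdG := lam_eq_natDegree_weierstrassDistinguished (eq_C_pow_mu_mul_pfree G) (red_pfree_ne_zero hG)
  have hmF := ((pfree F).isDistinguishedAt_weierstrassDistinguished (red_pfree_ne_zero hF)).monic
  have hmG := ((pfree G).isDistinguishedAt_weierstrassDistinguished (red_pfree_ne_zero hG)).monic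
  have heq : (pfree F).weierstrassDistinguished (red_pfree_ne_zero hF) = (pfree G).weierstrassDistinguished (red_pfree_ne_zero hG) :=
    Polynomial.eq_of_dvd_of_natDegree_le_of_leadingCoeff hP (by rw [← hdF, ← hdG, hlam]) (by rw [hmF.leadingCoeff, hmG.leadingCoeff])
  refine ⟨heq, ?_⟩
  have hfF := (pfree F).eq_weierstrassDistinguished_mul_weierstrassUnit (red_pfree_ne_zero hF)
  have hfG := (pfree G).eq_weierstrassDistinguished_mul_weierstrassUnit (red_pfree_ne_zero hG)
  obtain ⟨u, hu⟩ := (pfree F).isUnit_weierstrassUnit (red_pfree_ne_zero hF)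
  obtain ⟨v, hv⟩ := (pfree G).isUnit_weierstrassUnit (red_pfree_ne_zero hG)
  refine ⟨u⁻¹ * v, ?_⟩
  conv_lhs => rw [hfG, ← heq, ← hv]
  conv_rhs => rw [hfF, ← hu]
  rw [Units.val_mul, mul_assoc, ← mul_assoc (u : IwasawaAlgebra p), Units.mul_inv, one_mul]

end Lambda

/-! ## §4 `ι`-stable elements: Kato's divisibility in the coordinates `(μ, k, h)` -/

section Coordinates

open PowerSeries Literature.NumberTheory.EllipticCurves
  Literature.NumberTheory.EllipticCurves.IwasawaAlgebra
  Summit.BirchSwinnertonDyer.Rank1Residual.X1.MuLambda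
  Summit.BirchSwinnertonDyer.Rank1Residual.Iwasawa

variable {p : ℕ} [hp : Fact p.Prime]

/-- **The real counterpart of a NORMALISED twist-zero factorisation does not vanish at `−2`**: if `P = (T+2)^k·𝒯'_m(h)` with `k = ord_{−2}P` and
`h` monic of degree `m`, then `h(−2) ≠ 0`. [cite: MazurTateTeitelbaum1986Invent, Ch. I §17] -/
theorem eval_neg_two_ne_zero_of_twistZero {P h : Polynomial ℤ_[p]} {k m : ℕ} (hm : h.Monic) (hd : h.natDegree = m)
    (hk : k = P.rootMultiplicity (-2))
    (hP : P = (Polynomial.X + Polynomial.C 2) ^ k *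
      ∑ j ∈ Finset.range (m + 1), Polynomial.C (h.coeff j) * (Polynomial.X + Polynomial.C 1) ^ (m - j) *
        ((Polynomial.X + Polynomial.C 1) ^ 2 + Polynomial.C 1) ^ j) :
    h.eval (-2) ≠ 0 := by
  set A : Polynomial ℤ_[p] := ∑ j ∈ Finset.range (m + 1), Polynomial.C (h.coeff j) * (Polynomial.X + Polynomial.C 1) ^ (m - j) *
    ((Polynomial.X + Polynomial.C 1) ^ 2 + Polynomial.C 1) ^ j with hA
  have hXC : (Polynomial.X + Polynomial.C (2 : ℤ_[p])) = Polynomial.X - Polynomial.C (-2) := by rw [map_neg, sub_neg_eq_add]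
  have hAm : A.Monic := (monic_twistForm hm hd).1
  have hLne : (Polynomial.X + Polynomial.C (2 : ℤ_[p])) ^ k ≠ 0 := pow_ne_zero k (Polynomial.monic_X_add_C 2).ne_zero
  have hPne : P ≠ 0 := by rw [hP]; exact mul_ne_zero hLne hAm.ne_zero
  have hord : P.rootMultiplicity (-2) = k + A.rootMultiplicity (-2) := by
    conv_lhs => rw [hP]
    rw [Polynomial.rootMultiplicity_mul (by rw [← hP]; exact hPne), hXC, Polynomial.rootMultiplicity_X_sub_C_pow]
  have hA0 : A.rootMultiplicity (-2) = 0 := by omega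
  rw [Polynomial.rootMultiplicity_eq_zero_iff, Polynomial.IsRoot.def, hA, eval_neg_two_twistForm hd.le] at hA0
  intro h0
  exact hAm.ne_zero (hA0 (by rw [h0, mul_zero]))

/-- ★★★ **KATO'S DIVISIBILITY IN HALF-DEGREE COORDINATES.** `F, G ∈ Λ ∖ {0}` with distinguished polynomials (of the `p`-free parts) in
g51's twist-zero normal form `P_F = (T+2)^{k_F}·𝒯'_{m_F}(h_F)`, `k_F = ord_{T=−2}P_F`, and `P_G = (T+2)^{k_G}·𝒯'_{m_G}(h_G)` (`h_F, h_G ∈ ℤ_p[Y]`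
monic of degrees `m_F, m_G` — the real counterparts, `…HalfDescentTwistZero.exists_twistZero_realCounterpart`). If **`F ∣ p^a·G`** (Kato's shape)
then **`h_F ∣ h_G` in `ℤ_p[Y]`** and `k_F ≤ k_G + ord_{−2}𝒯'(h_G)`; with `k_G = ord_{−2}P_G` also normalised, **`k_F ≤ k_G`**. Reading for
C2 (`F = f_X`, `G` an integral lift of `L₂(f, α)`): the analytic real counterpart is a MULTIPLE of the algebraic one.
[cite: Kato2004Asterisque, Thm. 17.4 (1)(2) (p. 273)] [cite: GreenbergVatsal2000, p. 4] [cite: GoreskyTai2017RealStructuresOrdinary, App. §16.2 Prop. 36 (p0036)] -/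
theorem realCounterpart_dvd_of_dvd_C_pow_mul {F G : IwasawaAlgebra p} (hF : F ≠ 0) (hG : G ≠ 0) {a : ℕ}
    (hdvd : F ∣ PowerSeries.C ((p : ℤ_[p]) ^ a) * G) {k₁ m₁ k₂ m₂ : ℕ} {h₁ h₂ : Polynomial ℤ_[p]} (hm₁ : h₁.Monic)
    (hd₁ : h₁.natDegree = m₁) (hm₂ : h₂.Monic) (hd₂ : h₂.natDegree = m₂)
    (hk₁ : k₁ = ((pfree F).weierstrassDistinguished (red_pfree_ne_zero hF)).rootMultiplicity (-2))
    (hP₁ : (pfree F).weierstrassDistinguished (red_pfree_ne_zero hF) = (Polynomial.X + Polynomial.C 2) ^ k₁ *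
      ∑ j ∈ Finset.range (m₁ + 1), Polynomial.C (h₁.coeff j) * (Polynomial.X + Polynomial.C 1) ^ (m₁ - j) *
        ((Polynomial.X + Polynomial.C 1) ^ 2 + Polynomial.C 1) ^ j)
    (hP₂ : (pfree G).weierstrassDistinguished (red_pfree_ne_zero hG) = (Polynomial.X + Polynomial.C 2) ^ k₂ *
      ∑ j ∈ Finset.range (m₂ + 1), Polynomial.C (h₂.coeff j) * (Polynomial.X + Polynomial.C 1) ^ (m₂ - j) *
        ((Polynomial.X + Polynomial.C 1) ^ 2 + Polynomial.C 1) ^ j) :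
    h₁ ∣ h₂ ∧ k₁ ≤ k₂ + (∑ j ∈ Finset.range (m₂ + 1), Polynomial.C (h₂.coeff j) * (Polynomial.X + Polynomial.C 1) ^ (m₂ - j) *
        ((Polynomial.X + Polynomial.C 1) ^ 2 + Polynomial.C 1) ^ j).rootMultiplicity (-2) ∧
      (k₂ = ((pfree G).weierstrassDistinguished (red_pfree_ne_zero hG)).rootMultiplicity (-2) → k₁ ≤ k₂) := by
  have hP := weierstrassDistinguished_pfree_dvd_of_dvd_C_pow_mul hF hG hdvd
  rw [hP₁, hP₂] at hP
  have hroot₁ := eval_neg_two_ne_zero_of_twistZero hm₁ hd₁ hk₁ hP₁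
  obtain ⟨hdiv, hk⟩ := dvd_of_twistZero_mul_dvd hm₁ hd₁ hm₂ hd₂ hroot₁ hP
  refine ⟨hdiv, hk, fun hk₂ ↦ ?_⟩
  exact (dvd_and_le_of_twistZero_mul_dvd hm₁ hd₁ hm₂ hd₂ hroot₁ (eval_neg_two_ne_zero_of_twistZero hm₂ hd₂ hk₂ hP₂) hP).2

/-- ★★ **RIGIDITY IN COORDINATES: `F ∣ p^a·G` and `λ(F) = λ(G)` ⟹ `k_F = k_G` and `h_F = h_G`** (both factorisations normalised): Kato's divisibility
plus the equality of `λ`-invariants pins the twist-zero order and the real counterpart; what is left of the main conjecture is `μ_F = μ_G`.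
[cite: GreenbergVatsal2000, p. 4 (after Thm. (1.2))] [cite: GreenbergLNM1716, p. 180] -/
theorem realCounterpart_eq_of_dvd_C_pow_mul_of_lam_eq {F G : IwasawaAlgebra p} (hF : F ≠ 0) (hG : G ≠ 0) {a : ℕ}
    (hdvd : F ∣ PowerSeries.C ((p : ℤ_[p]) ^ a) * G) (hlam : lam F = lam G) {k₁ m₁ k₂ m₂ : ℕ} {h₁ h₂ : Polynomial ℤ_[p]}
    (hm₁ : h₁.Monic) (hd₁ : h₁.natDegree = m₁) (hm₂ : h₂.Monic) (hd₂ : h₂.natDegree = m₂)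
    (hk₁ : k₁ = ((pfree F).weierstrassDistinguished (red_pfree_ne_zero hF)).rootMultiplicity (-2))
    (hk₂ : k₂ = ((pfree G).weierstrassDistinguished (red_pfree_ne_zero hG)).rootMultiplicity (-2))
    (hP₁ : (pfree F).weierstrassDistinguished (red_pfree_ne_zero hF) = (Polynomial.X + Polynomial.C 2) ^ k₁ *
      ∑ j ∈ Finset.range (m₁ + 1), Polynomial.C (h₁.coeff j) * (Polynomial.X + Polynomial.C 1) ^ (m₁ - j) *
        ((Polynomial.X + Polynomial.C 1) ^ 2 + Polynomial.C 1) ^ j)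
    (hP₂ : (pfree G).weierstrassDistinguished (red_pfree_ne_zero hG) = (Polynomial.X + Polynomial.C 2) ^ k₂ *
      ∑ j ∈ Finset.range (m₂ + 1), Polynomial.C (h₂.coeff j) * (Polynomial.X + Polynomial.C 1) ^ (m₂ - j) *
        ((Polynomial.X + Polynomial.C 1) ^ 2 + Polynomial.C 1) ^ j) :
    k₁ = k₂ ∧ m₁ = m₂ ∧ h₁ = h₂ := by
  obtain ⟨heq, -⟩ := weierstrassDistinguished_eq_of_dvd_of_lam_eq hF hG hdvd hlam
  have hk : k₁ = k₂ := by rw [hk₁, hk₂, heq]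
  subst hk
  rw [heq] at hP₁
  have hfac := hP₂.symm.trans hP₁
  -- degrees: `2 m₂ = 2 m₁`
  have hne : (Polynomial.X + Polynomial.C (2 : ℤ_[p])) ^ k₁ ≠ 0 := pow_ne_zero k₁ (Polynomial.monic_X_add_C 2).ne_zero
  have h12 := mul_left_cancel₀ hne hfac
  have hm : m₁ = m₂ := by
    -- compare degrees of the two twist forms (`2m₂ = 2m₁`)
    have hc := congrArg Polynomial.natDegree h12
    rw [(monic_twistForm hm₂ hd₂).2, (monic_twistForm hm₁ hd₁).2] at hc
    omega
  subst hm
  exact ⟨rfl, rfl, Summit.BirchSwinnertonDyer.BirchSwinnertonDyer.Theorems.AlignedTransportAtTwoHalfDescentTwistZero.realCounterpart_unique_of_twistZero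
    hd₂.le hd₁.le hfac |>.symm⟩

end Coordinates

end Summit.BirchSwinnertonDyer.BirchSwinnertonDyer.Theorems.AlignedTransportAtTwoHalfDescentKato

end
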